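import Literature.Analysis.Matrix.LogDetMixedDifferenceExpLocalised
import HarnessLib

/-!
# Localised response, III: locality of a finite-range matrix-valued map turns a localised motion of the argument into
# PROFILE ROWS for the matrix family (the bridge from the response bound to the rectangle theorem)

Topic `Literature/Analysis/Matrix`; namespace `Literature.Analysis.Matrix`.  Sequel of `LocalisedResponse.lean` (the response of a
non-degenerate critical point to a bond move is exponentially localised) and `LogDetMixedDifferenceExpLocalised.lean` (the rectangle
`Δ² log det` under PROFILE rows `hD`∕`hE` on the variations of the matrix family).  Everything here is PROVED; no definitions, no named
facts.

THE BRIDGE ([Balaban1985Variational] Thm 1, (10) p. 279 with [Balaban1984PropagatorsII] (1.33): «the Hessian at the background inherits the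
localisation of the background»).  A matrix-valued map `H : (n → ℝ) → Matrix n n ℝ` (the Hessian of a finite-range action as a function of
the configuration) is LOCAL with radius `r` and entrywise Lipschitz constant `L` if
`|H U i j − H U′ i j| ≤ L · Σ_{k : dist i k ≤ r} |U k − U′ k|` — the entry `(i,j)` reads the configuration only in the `r`-ball around
`i`.  If the configuration moves by a vector localised along a 1-Lipschitz profile `d` (`|U k − U′ k| ≤ δ·e^{−θ·d k}`), the entries of
`H` move by `≤ L·B·δ·e^{θr}·e^{−θ·d i}` (`B` a bound on the ball cardinalities): the ROW∕COLUMN PROFILE rows `hE`∕`hD` of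
`abs_fourPt_log_det_le_of_expLocalised`.  The same algebra bounds a DERIVATIVE `M′ i j = Σ_k P i j k · U′ k` whose coefficient tensor
`P` (the partial derivatives `∂_k H i j`) vanishes for `dist i k > r` and is `≤ L` entrywise.

* §1 `sum_ball_abs_le` — `Σ_{k : dist i k ≤ r} |v k| ≤ B·η·e^{θr}·e^{−θ·d i}` for `|v k| ≤ η·e^{−θ·d k}`, `#ball ≤ B`;
  ★`abs_sub_le_of_local_of_expLocalised` — locality + Lipschitz + localised displacement ⟹ localised variation of every entry
  (the `t`-difference row `hE`, read with the row profile `d′ = d`; the column reading for `hD` is the same statement applied to `Hᵀ`'s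
  locality in the column index, or to a symmetric `H`);
  ★`abs_deriv_entry_le_of_local` — the derivative form with a coefficient tensor `P` of range `r` (the `s`-derivative row `hD`∕`hM′`).
* §2 `hasDerivAt_entry_comp` — the chain-rule door: `HasFDerivAt (fun U => H U i j) φ (U s)` and `HasDerivAt U U′ s` give
  `HasDerivAt (fun s => H (U s) i j) (φ U′) s`; the coefficient tensor is `P i j k := φ_{ij} (Pi.single k 1)` via the tree's
  `Literature.Analysis.Convex.MinMax.dual_apply_eq_sum` (`f z = Σ_i z i * f (Pi.single i 1)`; not re-stated here).

HONEST SCOPE: bookkeeping inequalities and one chain rule; the locality∕Lipschitz facts of a specific Hessian (e.g. the Wilson action's)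
are NOT here.  Nothing here bears on the Yang–Mills mass gap (Clay), which is NOT proved.

References: T. Bałaban, CMP 102 (1985) 277, Thm 1, (10) p. 279 [Balaban1985Variational]; CMP 96 (1984) 223, (1.33) [Balaban1984PropagatorsII];
W. Rudin, *Principles of Mathematical Analysis* (1976) Thm 9.15 (chain rule) [Rudin1976].
-/

noncomputable section

open Matrix Finset
open scoped Matrix

namespace Literature.Analysis.Matrix

variable {n : Type*} [Fintype n] [DecidableEq n]

/-! ## §1 Locality + Lipschitz ⟹ localised variation -/

omit [DecidableEq n] in
/-- The mass of a profile-localised vector in an `r`-ball: if `|v k| ≤ η·e^{−θ·d k}` with `d` 1-Lipschitz (`d i ≤ dist i k + d k`),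
`θ ≥ 0`, and the ball `{k | dist i k ≤ r}` has at most `B` elements, then `Σ_{k : dist i k ≤ r} |v k| ≤ B·η·e^{θr}·e^{−θ·d i}`.
[cite: Balaban1985Variational, Thm 1 (10) p. 279 (localisation bookkeeping)] -/
theorem sum_ball_abs_le (dist : n → n → ℕ) {θ : ℝ} (hθ : 0 ≤ θ) {d : n → ℕ} (hd : ∀ i k, d i ≤ dist i k + d k)
    {v : n → ℝ} {η : ℝ} (hη : 0 ≤ η) (hv : ∀ k, |v k| ≤ η * Real.exp (-(θ * d k)))
    {r : ℕ} {B : ℝ} (i : n) (hB : ((univ.filter fun k => dist i k ≤ r).card : ℝ) ≤ B) :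
    ∑ k ∈ univ.filter (fun k => dist i k ≤ r), |v k| ≤ B * η * Real.exp (θ * r) * Real.exp (-(θ * d i)) := by
  have hterm : ∀ k ∈ univ.filter (fun k => dist i k ≤ r), |v k| ≤ η * Real.exp (θ * r) * Real.exp (-(θ * d i)) := by
    intro k hk
    rw [Finset.mem_filter] at hk
    refine (hv k).trans ?_
    rw [mul_assoc, ← Real.exp_add]
    refine mul_le_mul_of_nonneg_left (Real.exp_le_exp.2 ?_) hη
    have h1 : (d i : ℝ) ≤ dist i k + d k := by exact_mod_cast hd i k
    have h2 : (dist i k : ℝ) ≤ r := by exact_mod_cast hk.2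
    nlinarith
  calc ∑ k ∈ univ.filter (fun k => dist i k ≤ r), |v k|
      ≤ ∑ _k ∈ univ.filter (fun k => dist i k ≤ r), η * Real.exp (θ * r) * Real.exp (-(θ * d i)) := Finset.sum_le_sum hterm
    _ = ((univ.filter fun k => dist i k ≤ r).card : ℝ) * (η * Real.exp (θ * r) * Real.exp (-(θ * d i))) := by
        rw [Finset.sum_const, nsmul_eq_mul]
    _ ≤ B * (η * Real.exp (θ * r) * Real.exp (-(θ * d i))) := mul_le_mul_of_nonneg_right hB (by positivity)
    _ = B * η * Real.exp (θ * r) * Real.exp (-(θ * d i)) := by ring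

omit [DecidableEq n] in
/-- ★ **LOCALITY + LIPSCHITZ ⟹ LOCALISED VARIATION.**  Let `H : (n → ℝ) → Matrix n n ℝ` be local of radius `r` with entrywise
Lipschitz constant `L` in the row index: `|H U i j − H U′ i j| ≤ L·Σ_{k : dist i k ≤ r} |U k − U′ k|`.  If the configuration moves by a
vector localised along a 1-Lipschitz profile `d` (`|U k − U′ k| ≤ δ·e^{−θ·d k}`, `θ ≥ 0`) and the `r`-balls have at most `B` elements, then
every entry moves by `|H U i j − H U′ i j| ≤ L·B·δ·e^{θr}·e^{−θ·d i}` — a ROW-PROFILE bound (the shape of the row `hE` of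
`abs_fourPt_log_det_le_of_expLocalised`; for the column-profile row `hD` apply the statement to a map local in the column index, e.g. a
symmetric `H`). [cite: Balaban1985Variational, Thm 1 (10) p. 279] -/
theorem abs_sub_le_of_local_of_expLocalised (dist : n → n → ℕ) {H : (n → ℝ) → Matrix n n ℝ} {L : ℝ} {r : ℕ} (hL : 0 ≤ L)
    (hloc : ∀ U U' i j, |H U i j - H U' i j| ≤ L * ∑ k ∈ univ.filter (fun k => dist i k ≤ r), |U k - U' k|)
    {θ : ℝ} (hθ : 0 ≤ θ) {d : n → ℕ} (hd : ∀ i k, d i ≤ dist i k + d k)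
    {B : ℝ} (hB : ∀ i, ((univ.filter fun k => dist i k ≤ r).card : ℝ) ≤ B)
    {U U' : n → ℝ} {δ : ℝ} (hδ : 0 ≤ δ) (hU : ∀ k, |U k - U' k| ≤ δ * Real.exp (-(θ * d k))) (i j : n) :
    |H U i j - H U' i j| ≤ L * B * δ * Real.exp (θ * r) * Real.exp (-(θ * d i)) := by
  refine (hloc U U' i j).trans ?_
  have h := sum_ball_abs_le dist hθ hd hδ hU i (hB i)
  calc L * ∑ k ∈ univ.filter (fun k => dist i k ≤ r), |U k - U' k| ≤ L * (B * δ * Real.exp (θ * r) * Real.exp (-(θ * d i))) :=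
        mul_le_mul_of_nonneg_left h hL
    _ = L * B * δ * Real.exp (θ * r) * Real.exp (-(θ * d i)) := by ring

omit [DecidableEq n] in
/-- ★ **THE DERIVATIVE FORM.**  If the `s`-derivative of the entry `(i,j)` of a matrix family is `M′ i j = Σ_k P i j k · U′ k` with a
coefficient tensor of range `r` in the row index (`dist i k > r → P i j k = 0`, i.e. `r < dist i k`) bounded by `L`, and the velocity
`U′` is localised along a 1-Lipschitz profile `d` (`|U′ k| ≤ δ·e^{−θ·d k}`), `r`-balls of cardinality `≤ B`, then
`|M′ i j| ≤ L·B·δ·e^{θr}·e^{−θ·d i}`. [cite: Balaban1985Variational, Thm 1 (10) p. 279] -/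
theorem abs_deriv_entry_le_of_local (dist : n → n → ℕ) {P : n → n → n → ℝ} {L : ℝ} {r : ℕ} (hL : 0 ≤ L)
    (hP0 : ∀ i j k, r < dist i k → P i j k = 0) (hPb : ∀ i j k, |P i j k| ≤ L)
    {θ : ℝ} (hθ : 0 ≤ θ) {d : n → ℕ} (hd : ∀ i k, d i ≤ dist i k + d k)
    {B : ℝ} (hB : ∀ i, ((univ.filter fun k => dist i k ≤ r).card : ℝ) ≤ B)
    {U' : n → ℝ} {δ : ℝ} (hδ : 0 ≤ δ) (hU' : ∀ k, |U' k| ≤ δ * Real.exp (-(θ * d k)))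
    {M' : Matrix n n ℝ} (hM' : ∀ i j, M' i j = ∑ k, P i j k * U' k) (i j : n) :
    |M' i j| ≤ L * B * δ * Real.exp (θ * r) * Real.exp (-(θ * d i)) := by
  rw [hM' i j]
  -- restrict the sum to the ball: off the ball the coefficient vanishes
  have hzero : ∀ k ∈ (univ : Finset n), k ∉ univ.filter (fun k => dist i k ≤ r) → P i j k * U' k = 0 := by
    intro k _ hk
    rw [Finset.mem_filter, not_and] at hk
    rw [hP0 i j k (not_le.mp (hk (Finset.mem_univ k))), zero_mul]
  rw [← Finset.sum_subset (Finset.subset_univ _) hzero]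
  refine (Finset.abs_sum_le_sum_abs _ _).trans ?_
  have h := sum_ball_abs_le dist hθ hd hδ hU' i (hB i)
  calc ∑ k ∈ univ.filter (fun k => dist i k ≤ r), |P i j k * U' k|
      ≤ ∑ k ∈ univ.filter (fun k => dist i k ≤ r), L * |U' k| := Finset.sum_le_sum fun k _ => by
          rw [abs_mul]; exact mul_le_mul_of_nonneg_right (hPb i j k) (abs_nonneg _)
    _ = L * ∑ k ∈ univ.filter (fun k => dist i k ≤ r), |U' k| := by rw [Finset.mul_sum]
    _ ≤ L * (B * δ * Real.exp (θ * r) * Real.exp (-(θ * d i))) := mul_le_mul_of_nonneg_left h hL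
    _ = L * B * δ * Real.exp (θ * r) * Real.exp (-(θ * d i)) := by ring

/-! ## §2 The chain-rule door for an entry of a composed matrix family -/

omit [DecidableEq n] in
/-- **Chain rule for an entry of `s ↦ H (U s)`**: if `U` has derivative `U′` at `s` and the entry map `V ↦ H V i j` has Fréchet derivative
`φ` at `U s`, then `s ↦ H (U s) i j` has derivative `φ U′` at `s` (and `φ U′ = Σ_k U′ k * φ (Pi.single k 1)` by
`Literature.Analysis.Convex.MinMax.dual_apply_eq_sum`, which names the coefficient tensor of `abs_deriv_entry_le_of_local`).
[cite: Rudin1976, Thm 9.15 (chain rule)] -/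
theorem hasDerivAt_entry_comp {H : (n → ℝ) → Matrix n n ℝ} {U : ℝ → (n → ℝ)} {U' : n → ℝ} {s : ℝ} {i j : n}
    {φ : (n → ℝ) →L[ℝ] ℝ} (hH : HasFDerivAt (fun V => H V i j) φ (U s)) (hU : HasDerivAt U U' s) :
    HasDerivAt (fun s => H (U s) i j) (φ U') s :=
  hH.comp_hasDerivAt s hU

end Literature.Analysis.Matrix

end
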